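import Literature.Analysis.Pluripotential.NonPluripolarMongeAmpereMassProofs
import HarnessLib

/-!
# Regularisation of the chart potential of a closed positive current

Topic `Literature/Analysis/Pluripotential`. Step (P5) of the proof of the named fact
`GuedjZeriahi2007_lelongNumber_eq_zero_of_regularMass_eq` (`NonPluripolarMongeAmpereMass.lean`),
assembled from the mollifier files of the tree (`MollifierSubMeanValue.lean`,
`MollifierLeviConvergence.lean`, `ChartPotentialIntegrability.lean`): the mollifications
`g_n = ρ_n ⋆ g` (`mollifiedChartPotential T ε₀ hε₀ n`, normed bumps `smallBump ε₀ hε₀ n` of outer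
radius `ε₀/(n+2)`) of the chart potential `g` of a closed positive `(1,1)`-current are smooth with
non-negative Levi form (`levi_mollifiedChartPotential_nonneg`, from the a.e. sub-mean-value property
`ae_subMeanValue_chartPotential` of `NonPluripolarMongeAmpereMassProofs.lean`), grow at most like `deg T · fsPotential + M`
(`mollifiedChartPotential_le`), are bounded above by any upper bound of the cone potential on the
`ε₀`-ball (`mollifiedChartPotential_le_of_pot_le` — poles are Lebesgue-null) and below by any lower
bound of the chart potential there (`le_mollifiedChartPotential_of_le`), and their Monge–Ampère
densities converge to `MA(g)` at every point of the regular locus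
(`tendsto_heightDensity_mollifiedChartPotential`). Packaged: `ClosedPositiveOneOneCurrent.exists_regularisation`.
The two definitions have explicit bodies; everything is proved.

## References

* [HormanderSCV1973] L. Hörmander, An introduction to complex analysis in several variables (1973),
  Thm. 2.6.3 (regularisation of psh functions by convolution).
-/

noncomputable section

open scoped Topology ENNReal Convolution ContDiff ComplexOrder
open MeasureTheory Filter Set Metric Complex ContinuousLinearMap
open Literature.AlgebraicGeometry.HodgeTheory.BiextensionHeight (leviMatrix fsPotential
    heightDensity chartVec)

namespace Literature.Analysis.Pluripotential

variable {N : ℕ}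

/-! ### The mollifying bumps -/

/-- The normed bump of outer radius `ε₀/(n+2)` and inner radius half of it. [folklore] -/
def smallBump (ε₀ : ℝ) (hε₀ : 0 < ε₀) (n : ℕ) : ContDiffBump (0 : Fin N → ℂ) where
  rIn := ε₀ / (n + 2) / 2
  rOut := ε₀ / (n + 2)
  rIn_pos := by positivity
  rIn_lt_rOut := by
    have : 0 < ε₀ / (n + 2) := by positivity
    linarith

/-- The outer radius of the `n`-th bump. [folklore] -/
theorem smallBump_rOut (ε₀ : ℝ) (hε₀ : 0 < ε₀) (n : ℕ) :
    (smallBump (N := N) ε₀ hε₀ n).rOut = ε₀ / (n + 2) := rfl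

/-- The outer radii are `≤ ε₀/2`. [folklore] -/
theorem smallBump_rOut_le (ε₀ : ℝ) (hε₀ : 0 < ε₀) (n : ℕ) :
    (smallBump (N := N) ε₀ hε₀ n).rOut ≤ ε₀ / 2 := by
  rw [smallBump_rOut]
  gcongr
  norm_cast; omega

/-- The outer radii tend to `0`. [folklore] -/
theorem tendsto_smallBump_rOut (ε₀ : ℝ) (hε₀ : 0 < ε₀) :
    Tendsto (fun n ↦ (smallBump (N := N) ε₀ hε₀ n).rOut) atTop (𝓝 0) := by
  simp_rw [smallBump_rOut]
  have h : Tendsto (fun n : ℕ ↦ ε₀ / ((n : ℝ) + 2)) atTop (𝓝 0) := by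
    have h1 : Tendsto (fun n : ℕ ↦ (n : ℝ) + 2) atTop atTop :=
      tendsto_natCast_atTop_atTop.atTop_add tendsto_const_nhds
    exact tendsto_const_nhds.div_atTop h1
  exact h

namespace ClosedPositiveOneOneCurrent

variable (T : ClosedPositiveOneOneCurrent N)

/-- The `n`-th mollification `g_n = ρ_n ⋆ g` of the chart potential (scale `ε₀/(n+2)`). [folklore] -/
def mollifiedChartPotential (ε₀ : ℝ) (hε₀ : 0 < ε₀) (n : ℕ) : (Fin N → ℂ) → ℝ :=
  (smallBump ε₀ hε₀ n).normed volume ⋆[lsmul ℝ ℝ, volume] T.chartPotential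

variable {T}

/-- `g_n` is smooth. [folklore] -/
theorem contDiff_mollifiedChartPotential (ε₀ : ℝ) (hε₀ : 0 < ε₀) (n : ℕ) {m : ℕ∞} :
    ContDiff ℝ m (T.mollifiedChartPotential ε₀ hε₀ n) :=
  (contDiff_normed_convolution _ T.locallyIntegrable_chartPotential).of_le (mod_cast le_top)

/-- `g_n` has non-negative Levi form. [folklore] -/
theorem levi_mollifiedChartPotential_nonneg (ε₀ : ℝ) (hε₀ : 0 < ε₀) (n : ℕ) (w v : Fin N → ℂ) :
    0 ≤ fderiv ℝ (fderiv ℝ (T.mollifiedChartPotential ε₀ hε₀ n)) w v v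
      + fderiv ℝ (fderiv ℝ (T.mollifiedChartPotential ε₀ hε₀ n)) w (I • v) (I • v) :=
  levi_nonneg_of_posSemidef_leviMatrix (posSemidef_leviMatrix_normed_convolution _
    T.locallyIntegrable_chartPotential T.ae_subMeanValue_chartPotential w) v

/-- **Growth of `g_n`**, uniformly in `n` and `ε₀ ≤ 1`. [folklore] -/
theorem mollifiedChartPotential_le {ε₀ : ℝ} (hε₀ : 0 < ε₀) (hε₁ : ε₀ ≤ 1) {C₀ : ℝ}
    (hle : ∀ w, T.chartPotential w ≤ T.degree * fsPotential w + C₀) (n : ℕ) (w : Fin N → ℂ) :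
    T.mollifiedChartPotential ε₀ hε₀ n w
      ≤ T.degree * fsPotential w + (C₀ + T.degree * (Real.log (2 * (1 + N)) / 2)) :=
  normed_convolution_le_fsPotential _ ((smallBump_rOut_le ε₀ hε₀ n).trans (by linarith))
    T.locallyIntegrable_chartPotential T.degree_nonneg hle w

/-- **Upper bound of `g_n` from an upper bound of the cone potential on a ball** (poles are null,
so the junk values of the real chart potential do not matter). [folklore] -/
theorem mollifiedChartPotential_le_of_pot_le {ε₀ : ℝ} (hε₀ : 0 < ε₀) (n : ℕ) {w : Fin N → ℂ} {m : ℝ}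
    (hm : ∀ y ∈ closedBall w ε₀, T.pot (chartVec y) ≤ (m : EReal)) :
    T.mollifiedChartPotential ε₀ hε₀ n w ≤ m := by
  set φ := smallBump (N := N) ε₀ hε₀ n with hφ
  have hrOut : φ.rOut ≤ ε₀ := (smallBump_rOut_le ε₀ hε₀ n).trans (by linarith)
  rw [mollifiedChartPotential, convolution_lsmul]
  -- poles are null, also after the reflection `t ↦ w - t`
  have hae : ∀ᵐ t : Fin N → ℂ, T.pot (chartVec (w - t)) ≠ ⊥ :=
    (Measure.measurePreserving_sub_left volume w).quasiMeasurePreserving.ae T.ae_pot_chartVec_ne_bot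
  have hpt : ∀ᵐ t : Fin N → ℂ, φ.normed volume t * T.chartPotential (w - t) ≤ φ.normed volume t * m := by
    filter_upwards [hae] with t ht
    by_cases htb : t ∈ ball (0 : Fin N → ℂ) φ.rOut
    · refine mul_le_mul_of_nonneg_left ?_ (φ.nonneg_normed t)
      have hy : w - t ∈ closedBall w ε₀ := by
        rw [mem_closedBall, dist_eq_norm, sub_sub_cancel_left, norm_neg]
        exact ((mem_ball_zero_iff.1 htb).le.trans hrOut)
      have h := hm _ hy
      have hlt : T.pot (chartVec (w - t)) < ⊤ := T.pot_lt_top (chartVec_ne_zero _)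
      rw [chartPotential]
      rw [← EReal.coe_toReal hlt.ne ht] at h
      exact_mod_cast h
    · have h0 : φ.normed volume t = 0 := by
        have : t ∉ Function.support (φ.normed volume) := by rwa [φ.support_normed_eq]
        simpa using this
      simp [h0]
  calc ∫ t, φ.normed volume t * T.chartPotential (w - t)
      ≤ ∫ t, φ.normed volume t * m := by
        refine integral_mono_ae ?_ (φ.integrable_normed.mul_const m) hpt
        exact φ.hasCompactSupport_normed.convolutionExists_left (lsmul ℝ ℝ) φ.continuous_normed
          T.locallyIntegrable_chartPotential w
    _ = m := by rw [integral_mul_const, φ.integral_normed, one_mul]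

/-- **Lower bound of `g_n` from a lower bound of the chart potential on a ball.** [folklore] -/
theorem le_mollifiedChartPotential_of_le {ε₀ : ℝ} (hε₀ : 0 < ε₀) (n : ℕ) {w : Fin N → ℂ} {m : ℝ}
    (hm : ∀ y ∈ closedBall w ε₀, m ≤ T.chartPotential y) :
    m ≤ T.mollifiedChartPotential ε₀ hε₀ n w := by
  set φ := smallBump (N := N) ε₀ hε₀ n with hφ
  have hrOut : φ.rOut ≤ ε₀ := (smallBump_rOut_le ε₀ hε₀ n).trans (by linarith)
  rw [mollifiedChartPotential, convolution_lsmul]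
  have hpt : ∀ t, φ.normed volume t * m ≤ φ.normed volume t * T.chartPotential (w - t) := by
    intro t
    by_cases htb : t ∈ ball (0 : Fin N → ℂ) φ.rOut
    · refine mul_le_mul_of_nonneg_left (hm _ ?_) (φ.nonneg_normed t)
      rw [mem_closedBall, dist_eq_norm, sub_sub_cancel_left, norm_neg]
      exact ((mem_ball_zero_iff.1 htb).le.trans hrOut)
    · have h0 : φ.normed volume t = 0 := by
        have : t ∉ Function.support (φ.normed volume) := by rwa [φ.support_normed_eq]
        simpa using this
      simp [h0]
  calc m = ∫ t, φ.normed volume t * m := by rw [integral_mul_const, φ.integral_normed, one_mul]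
    _ ≤ ∫ t, φ.normed volume t * T.chartPotential (w - t) := by
        refine integral_mono (φ.integrable_normed.mul_const m) ?_ hpt
        exact φ.hasCompactSupport_normed.convolutionExists_left (lsmul ℝ ℝ) φ.continuous_normed
          T.locallyIntegrable_chartPotential w

/-- **Convergence of the Monge–Ampère densities of `g_n` on the regular locus.** [folklore] -/
theorem tendsto_heightDensity_mollifiedChartPotential {ε₀ : ℝ} (hε₀ : 0 < ε₀) {w : Fin N → ℂ}
    (hw : w ∈ T.regularLocus) :
    Tendsto (fun n ↦ heightDensity N (T.mollifiedChartPotential ε₀ hε₀ n) w) atTop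
      (𝓝 (heightDensity N T.chartPotential w)) := by
  have hL : Tendsto (fun n ↦ leviMatrix (T.mollifiedChartPotential ε₀ hε₀ n) w) atTop
      (𝓝 (leviMatrix T.chartPotential w)) := by
    refine tendsto_pi_nhds.2 fun p ↦ tendsto_pi_nhds.2 fun q ↦ ?_
    exact tendsto_leviMatrix_normed_convolution (tendsto_smallBump_rOut ε₀ hε₀)
      T.isOpen_regularLocus (fun y hy ↦ hy) hw p q
  have hdet : Tendsto (fun n ↦ (leviMatrix (T.mollifiedChartPotential ε₀ hε₀ n) w).det) atTop
      (𝓝 (leviMatrix T.chartPotential w).det) :=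
    ((continuous_id.matrix_det).tendsto _).comp hL
  simp_rw [heightDensity_self_eq]
  exact ((Complex.continuous_re.tendsto _).comp hdet).const_mul _

variable (T)

/-- **Regularisation of the chart potential** (statement consumed by the proof of
`GuedjZeriahi2007_lelongNumber_eq_zero_of_regularMass_eq`): there is `M` such that for every scale
`ε₀ ∈ (0, 1]` the mollifications `g_n` (`n ∈ ℕ`, scale `ε₀/(n+2)`) are `C³` with non-negative Levi
form, grow at most like `deg T · fsPotential + M`, are controlled from above by the cone potential
and from below by the chart potential on `ε₀`-balls, and their Monge–Ampère densities converge to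
that of the chart potential at every point of the regular locus.
[cite: HormanderSCV1973, Thm. 2.6.3 (regularisation of psh functions)] -/
theorem exists_regularisation :
    ∃ M : ℝ, ∀ ε₀ : ℝ, ∀ hε₀ : 0 < ε₀, ε₀ ≤ 1 →
      (∀ n, ContDiff ℝ 3 (T.mollifiedChartPotential ε₀ hε₀ n)) ∧
      (∀ n w v, 0 ≤ fderiv ℝ (fderiv ℝ (T.mollifiedChartPotential ε₀ hε₀ n)) w v v
        + fderiv ℝ (fderiv ℝ (T.mollifiedChartPotential ε₀ hε₀ n)) w (I • v) (I • v)) ∧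
      (∀ n w, T.mollifiedChartPotential ε₀ hε₀ n w ≤ T.degree * fsPotential w + M) ∧
      (∀ n (w : Fin N → ℂ) (m : ℝ), (∀ y ∈ closedBall w ε₀, T.pot (chartVec y) ≤ (m : EReal)) →
        T.mollifiedChartPotential ε₀ hε₀ n w ≤ m) ∧
      (∀ n (w : Fin N → ℂ) (m : ℝ), (∀ y ∈ closedBall w ε₀, m ≤ T.chartPotential y) →
        m ≤ T.mollifiedChartPotential ε₀ hε₀ n w) ∧
      (∀ w ∈ T.regularLocus, Tendsto (fun n ↦ heightDensity N (T.mollifiedChartPotential ε₀ hε₀ n) w)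
        atTop (𝓝 (heightDensity N T.chartPotential w))) := by
  obtain ⟨C₀, -, hC₀⟩ := T.exists_chartPotential_le
  refine ⟨C₀ + T.degree * (Real.log (2 * (1 + N)) / 2), fun ε₀ hε₀ hε₁ ↦ ⟨?_, ?_, ?_, ?_, ?_, ?_⟩⟩
  · exact fun n ↦ contDiff_mollifiedChartPotential ε₀ hε₀ n
  · exact fun n w v ↦ levi_mollifiedChartPotential_nonneg ε₀ hε₀ n w v
  · exact fun n w ↦ mollifiedChartPotential_le hε₀ hε₁ hC₀ n w
  · exact fun n w m hm ↦ mollifiedChartPotential_le_of_pot_le hε₀ n hm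
  · exact fun n w m hm ↦ le_mollifiedChartPotential_of_le hε₀ n hm
  · exact fun w hw ↦ tendsto_heightDensity_mollifiedChartPotential hε₀ hw

end ClosedPositiveOneOneCurrent

end Literature.Analysis.Pluripotential

end
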